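import Summits.BirchSwinnertonDyer.BirchSwinnertonDyer.Theorems.CountingDoorF2AtThreeSelmerAverageInterface
import Literature.NumberTheory.EllipticCurves.BhargavaHo2022.LargeFamilyCount
import HarnessLib

/-!
# BirchSwinnertonDyer / CountingDoorF2AtThree — support lemmas for crux I1
# `SelmerThreeAverageLargeF2` (stmt-BirchSwinnertonDyer-19440): the large-family sieve reduction
# (an average bound on a LARGE subfamily from the bounds on its finitely-conditioned truncations)

Route `route-BirchSwinnertonDyer-CountingDoorF2AtThree` (cell bsd-rank2; TWIN leaf
`PAdicBSDRankTwoPositiveProportion`). Crux I1 asks `Φ.AverageOnLE (fun a ↦ #Sel₃(E_a)) 36` for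
EVERY LARGE subfamily `Φ` of Bhargava–Ho's `F₂` (infinitely many congruence conditions). Every
first-moment method in print proves such a bound first for families defined by FINITELY many
congruence conditions (a weighted lattice-point count) and passes to large families by a sieve:
the numerator only grows when the conditions at the primes `p ≥ Y` are dropped, and the denominator
`#Φ(<X)` is recovered up to a factor `1 + δ(Y)`, `δ(Y) → 0`, from the uniformity ("tail") estimate
for `p² ∣ Δ`, `p ≥ Y`, and the positive density of `Φ` (Bhargava–Shankar, Ann. Math. 181 (2015)
§2.7, proof of Thm 2.21: "`limsup_X N_φ/X^{5/6} ≤ limsup_X N^Y_{ψ'}/X^{5/6}` … Letting `Y` tend to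
infinity"; Bhargava–Ho 2022 §9.1, Thm. 9.1 and Prop. 9.2 for `F₂`). This file proves that passage
as bookkeeping over the tree's vocabulary (`BhargavaHo2022.CongruenceFamily₂`, `AverageOnLE`,
`below`, `IsLarge`), for an arbitrary nonnegative invariant `f` and constant `c ≥ 0`:

* `sum_le_sum_of_subfamily`, `averageOnLE_mul_of_subfamily`: if `Φ ⊆ Ψ` (member-wise), `f ≥ 0`,
  `Ψ.AverageOnLE f c` and eventually `#Ψ(<X) ≤ (1 + δ)·#Φ(<X)`, then
  `Φ.AverageOnLE f (c·(1 + δ))`… packaged as: for every `ε > 0`, eventually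
  `∑_{Φ(<X)} f ≤ (c + ε)(1 + δ)·#Φ(<X)`;
* `averageOnLE_of_forall_subfamily`: if for every `δ > 0` such a `Ψ_δ` exists, `Φ.AverageOnLE f c`;
* `card_below_le_of_tail` : if `Ψ ∖ Φ ⊆ T` (member-wise), `#{a ∈ F₂(<X) | T a} ≤ η·#F₂(<X)` and
  `κ·#F₂(<X) ≤ #Φ(<X)` eventually (`κ > 0`), then eventually `#Ψ(<X) ≤ (1 + η/κ)·#Φ(<X)`;
* `averageOnLE_of_isLarge_of_truncations` (**the sieve reduction**): for a LARGE `Φ` of positive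
  lower relative density in `F₂`, `Φ.AverageOnLE f c` follows from the same bound for the
  truncations `Φ_{<Y}` (the conditions of `Φ` at the primes `p < Y` only — finitely many
  congruence conditions) for all large `Y`, plus the tail estimate "the members of `F₂` with
  `p² ∣ Δ` for some prime `p ≥ Y` have upper relative density `≤ η(Y) → 0`" (largeness at `p ≥ p₀`
  puts `Φ_{<Y} ∖ Φ` inside that tail for `Y ≥ p₀`);
* `selmerThreeAverageLE_of_truncations`, `selmerThreeAverageLargeF2_of_finiteConditions`: the
  instances for `f = #Sel₃`, `c = 36`; the second concludes the route decl
  `SelmerThreeAverageLargeF2` BY NAME from (i) I1 for the families with FINITELY many congruence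
  conditions, (ii) the tail estimate, (iii) Bhargava–Ho Thm. 9.1 (`thm9_1_F2`, named fact of the
  tree, used through its proved corollary `thm9_1_F2.relative`; an empty local condition makes `Φ`
  empty and the bound trivial) — and `selmerThreeAverage_finiteConditions_of_largeF2` is the
  converse, so modulo (ii)–(iii) I1 is EQUIVALENT to its finitely-conditioned case.

Nothing of Bhargava–Ho is asserted: (i)–(iii) are explicit hypotheses. (ii) is the printed
Prop. 9.2 / Thm. 9.1 content "`#{a⃗ ∈ F : H(a⃗) < X, p² ∣ Δ(a⃗) for some p > Y}`" is negligible
(with Thm. 9.1's Euler product `∏_p M_p`, the tail has relative density `1 - ∏_{p ≥ Y} M_p → 0`);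
the tree's `thm9_1_F2` records only the positivity of the main-term constant, so (ii) is carried as
a hypothesis and not derived here. PARTITION: none — r_an ≥ 2, summit axis S0; TWIN (D-0056): n/a.
B1 honesty: counting bookkeeping toward an open crux; no analytic rank, no `L`-function; no S0
motion.

References: M. Bhargava, A. Shankar, Ann. of Math. 181 (2015) 191–242, §2.7 (proof of Thm 2.21,
upper bound) [BhargavaShankarAnnals2015]; M. Bhargava, W. Ho, arXiv:2207.03309 (2022), §9.1
Thm. 9.1, Prop. 9.2, §9.2 Thm. 9.6 [BhargavaHo2022].
-/

set_option linter.dupNamespace false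

noncomputable section

open scoped Classical
open Filter Topology Finset
open Literature.NumberTheory.EllipticCurves.BhargavaHo2022
  Summit.BirchSwinnertonDyer.Rank2
  Summit.BirchSwinnertonDyer.BirchSwinnertonDyer.Theses.CountingDoorF2AtThree

namespace Summit.BirchSwinnertonDyer.BirchSwinnertonDyer.Theorems

/-! ### §1 A subfamily's sum is bounded by the super-family's -/

/-- If every member of `Φ` is a member of `Ψ`, the height balls are nested: `Φ(<X) ⊆ Ψ(<X)`.
[folklore] -/
theorem below_subset_below_of_subfamily {Φ Ψ : CongruenceFamily₂} (hsub : ∀ a, Φ.Mem a → Ψ.Mem a)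
    (X : ℕ) : Φ.below X ⊆ Ψ.below X := fun a ha ↦ by
  rw [CongruenceFamily₂.mem_below_iff] at ha ⊢
  exact ⟨hsub a ha.1, ha.2⟩

/-- For `f ≥ 0` and `Φ ⊆ Ψ`, the sum of `f` over `Φ(<X)` is at most the sum over `Ψ(<X)`
(the numerator of an average only grows when congruence conditions are dropped). [folklore] -/
theorem sum_le_sum_of_subfamily {Φ Ψ : CongruenceFamily₂} (hsub : ∀ a, Φ.Mem a → Ψ.Mem a)
    {f : Params → ℝ} (hf : ∀ a, 0 ≤ f a) (X : ℕ) :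
    ∑ a ∈ Φ.below X, f a ≤ ∑ a ∈ Ψ.below X, f a :=
  Finset.sum_le_sum_of_subset_of_nonneg (below_subset_below_of_subfamily hsub X)
    fun a _ _ ↦ hf a

/-- **One sieve step.** `Φ ⊆ Ψ`, `f ≥ 0`, `Ψ.AverageOnLE f c` (`c ≥ 0`) and eventually
`#Ψ(<X) ≤ (1 + δ)·#Φ(<X)` give, for every `ε > 0`, eventually
`∑_{Φ(<X)} f ≤ (c + ε)·(1 + δ)·#Φ(<X)`. [cite: BhargavaShankarAnnals2015, §2.7 (proof of Thm 2.21, upper bound)] -/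
theorem sum_le_of_subfamily {Φ Ψ : CongruenceFamily₂} (hsub : ∀ a, Φ.Mem a → Ψ.Mem a)
    {f : Params → ℝ} (hf : ∀ a, 0 ≤ f a) {c δ : ℝ} (hc : 0 ≤ c)
    (hΨ : Ψ.AverageOnLE f c)
    (hcount : ∀ᶠ X : ℕ in atTop, ((Ψ.below X).card : ℝ) ≤ (1 + δ) * (Φ.below X).card)
    {ε : ℝ} (hε : 0 < ε) :
    ∀ᶠ X : ℕ in atTop, ∑ a ∈ Φ.below X, f a ≤ (c + ε) * (1 + δ) * (Φ.below X).card := by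
  have hΨ' := (averageOnLE_iff_forall_sum_le Ψ hc).1 hΨ ε hε
  filter_upwards [hΨ', hcount] with X hX hcX
  calc ∑ a ∈ Φ.below X, f a ≤ ∑ a ∈ Ψ.below X, f a := sum_le_sum_of_subfamily hsub hf X
    _ ≤ (c + ε) * (Ψ.below X).card := hX
    _ ≤ (c + ε) * ((1 + δ) * (Φ.below X).card) :=
        mul_le_mul_of_nonneg_left hcX (by linarith)
    _ = (c + ε) * (1 + δ) * (Φ.below X).card := by ring

/-- **The sieve limit `δ → 0`.** If `f ≥ 0`, `c ≥ 0`, and for every `δ > 0` there is a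
super-family `Ψ ⊇ Φ` with `Ψ.AverageOnLE f c` and eventually `#Ψ(<X) ≤ (1 + δ)·#Φ(<X)`, then
`Φ.AverageOnLE f c` ("Letting `Y` tend to infinity").
[cite: BhargavaShankarAnnals2015, §2.7 (proof of Thm 2.21, upper bound)] -/
theorem averageOnLE_of_forall_subfamily {Φ : CongruenceFamily₂} {f : Params → ℝ}
    (hf : ∀ a, 0 ≤ f a) {c : ℝ} (hc : 0 ≤ c)
    (H : ∀ δ : ℝ, 0 < δ → ∃ Ψ : CongruenceFamily₂, (∀ a, Φ.Mem a → Ψ.Mem a) ∧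
      Ψ.AverageOnLE f c ∧
        ∀ᶠ X : ℕ in atTop, ((Ψ.below X).card : ℝ) ≤ (1 + δ) * (Φ.below X).card) :
    Φ.AverageOnLE f c := by
  rw [averageOnLE_iff_forall_sum_le Φ hc]
  intro ε hε
  -- `δ := ε / (2c + ε + 1)`: then `(c + ε/2)(1 + δ) ≤ c + ε`
  set δ : ℝ := ε / (2 * c + ε + 1) with hδdef
  have hden : 0 < 2 * c + ε + 1 := by linarith
  have hδ : 0 < δ := div_pos hε hden
  obtain ⟨Ψ, hsub, hΨ, hcount⟩ := H δ hδ
  have hstep := sum_le_of_subfamily hsub hf hc hΨ hcount (half_pos hε)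
  refine hstep.mono fun X hX ↦ hX.trans (mul_le_mul_of_nonneg_right ?_ (Nat.cast_nonneg _))
  -- `(c + ε/2)(1 + δ) ≤ c + ε`
  have hkey : (c + ε / 2) * δ ≤ ε / 2 := by
    rw [hδdef, mul_div_assoc', div_le_div_iff₀ hden two_pos]
    nlinarith
  nlinarith

/-! ### §2 The denominator: super-family count from a tail estimate and positive density -/

/-- **Count comparison from a tail estimate.** If every member of `Ψ` outside `Φ` satisfies `T`,
the `T`-members of `F₂(<X)` are at most `η·#F₂(<X)` and `κ·#F₂(<X) ≤ #Φ(<X)` eventually (`κ > 0`,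
`η ≥ 0`), then eventually `#Ψ(<X) ≤ (1 + η/κ)·#Φ(<X)`. [cite: BhargavaHo2022, Thm. 9.1 and Prop. 9.2 (shape of their use)] -/
theorem card_below_le_of_tail {Φ Ψ : CongruenceFamily₂} {T : Params → Prop}
    (hT : ∀ a, Ψ.Mem a → ¬ Φ.Mem a → T a) {η κ : ℝ} (hη : 0 ≤ η) (hκ : 0 < κ)
    (htail : ∀ᶠ X : ℕ in atTop,
      (((CongruenceFamily₂.all.below X).filter T).card : ℝ) ≤
        η * (CongruenceFamily₂.all.below X).card)
    (hrel : ∀ᶠ X : ℕ in atTop,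
      κ * ((CongruenceFamily₂.all.below X).card : ℝ) ≤ (Φ.below X).card) :
    ∀ᶠ X : ℕ in atTop, ((Ψ.below X).card : ℝ) ≤ (1 + η / κ) * (Φ.below X).card := by
  filter_upwards [htail, hrel] with X hX hrX
  -- `Ψ(<X) ⊆ Φ(<X) ∪ {a ∈ F₂(<X) | T a}`
  have hcover : Ψ.below X ⊆ Φ.below X ∪ (CongruenceFamily₂.all.below X).filter T := by
    intro a ha
    rw [Finset.mem_union, Finset.mem_filter]
    by_cases hΦ : Φ.Mem a
    · left
      rw [CongruenceFamily₂.mem_below_iff] at ha ⊢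
      exact ⟨hΦ, ha.2⟩
    · right
      have ha' := ha
      rw [CongruenceFamily₂.mem_below_iff] at ha'
      exact ⟨Ψ.below_subset_all_below X ha, hT a ha'.1 hΦ⟩
  have hcard : ((Ψ.below X).card : ℝ) ≤
      (Φ.below X).card + ((CongruenceFamily₂.all.below X).filter T).card := by
    exact_mod_cast (Finset.card_le_card hcover).trans (Finset.card_union_le _ _)
  have htail' : (((CongruenceFamily₂.all.below X).filter T).card : ℝ) ≤
      η / κ * (Φ.below X).card := by
    calc (((CongruenceFamily₂.all.below X).filter T).card : ℝ)
        ≤ η * (CongruenceFamily₂.all.below X).card := hX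
      _ = η / κ * (κ * (CongruenceFamily₂.all.below X).card) := by
          field_simp
      _ ≤ η / κ * (Φ.below X).card :=
          mul_le_mul_of_nonneg_left hrX (div_nonneg hη hκ.le)
  linarith

/-! ### §3 The sieve reduction for a large family -/

/-- **The large-family sieve reduction.** Let `Φ ⊆ F₂` be LARGE (at every prime `p ≥ p₀`, every
member with `p² ∤ Δ` passes) with positive lower relative density in `F₂`
(`κ·#F₂(<X) ≤ #Φ(<X)` eventually), `f ≥ 0`, `c ≥ 0`. Suppose (i) for all large `Y` the TRUNCATION
`Φ_{<Y}` — the conditions of `Φ` at the primes `p < Y` only, none at `p ≥ Y`: finitely many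
congruence conditions — satisfies `Φ_{<Y}.AverageOnLE f c`, and (ii) the tail estimate: for every
`η > 0` there is `Y` such that eventually the members of `F₂(<X)` with `p² ∣ Δ` for some prime
`p ≥ Y` number at most `η·#F₂(<X)`. Then `Φ.AverageOnLE f c`. (For `Y ≥ p₀`, largeness puts
`Φ_{<Y} ∖ Φ` inside the tail.) [cite: BhargavaHo2022, §9.1 Thm. 9.1 and Prop. 9.2 (F = F₂); BhargavaShankarAnnals2015, §2.7] -/
theorem averageOnLE_of_isLarge_of_truncations {Φ : CongruenceFamily₂} (hΦ : Φ.IsLarge)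
    {f : Params → ℝ} (hf : ∀ a, 0 ≤ f a) {c : ℝ} (hc : 0 ≤ c)
    (hrel : ∃ κ : ℝ, 0 < κ ∧ ∀ᶠ X : ℕ in atTop,
      κ * ((CongruenceFamily₂.all.below X).card : ℝ) ≤ (Φ.below X).card)
    (htrunc : ∀ᶠ Y : ℕ in atTop,
      (⟨Φ.expt, fun p ↦ if p < Y then Φ.residues p else Set.univ⟩ : CongruenceFamily₂).AverageOnLE
        f c)
    (htail : ∀ η : ℝ, 0 < η → ∃ Y : ℕ, ∀ᶠ X : ℕ in atTop,
      (((CongruenceFamily₂.all.below X).filter fun a ↦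
          ∃ p : ℕ, Y ≤ p ∧ p.Prime ∧ (p : ℤ) ^ 2 ∣ a.curveInt.Δ).card : ℝ) ≤
        η * (CongruenceFamily₂.all.below X).card) :
    Φ.AverageOnLE f c := by
  obtain ⟨κ, hκ, hrelκ⟩ := hrel
  obtain ⟨p₀, hp₀⟩ := hΦ
  obtain ⟨N, hN⟩ := Filter.eventually_atTop.1 htrunc
  refine averageOnLE_of_forall_subfamily hf hc fun δ hδ ↦ ?_
  obtain ⟨Y, hY⟩ := htail (δ * κ) (mul_pos hδ hκ)
  -- the truncation level: at least `Y`, `p₀` and `N`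
  set Y' : ℕ := max (max Y p₀) N with hY'
  have hYY' : Y ≤ Y' := (le_max_left _ _).trans (le_max_left _ _)
  have hp₀Y' : p₀ ≤ Y' := (le_max_right _ _).trans (le_max_left _ _)
  set Ψ : CongruenceFamily₂ := ⟨Φ.expt, fun p ↦ if p < Y' then Φ.residues p else Set.univ⟩ with hΨ
  have hsub : ∀ a, Φ.Mem a → Ψ.Mem a := fun a ha ↦ by
    refine ⟨ha.1, fun p hp ↦ ?_⟩
    show Φ.residueOf p a ∈ (if p < Y' then Φ.residues p else Set.univ)
    split_ifs
    · exact ha.2 p hp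
    · exact Set.mem_univ _
  have hT : ∀ a, Ψ.Mem a → ¬ Φ.Mem a →
      ∃ p : ℕ, Y ≤ p ∧ p.Prime ∧ (p : ℤ) ^ 2 ∣ a.curveInt.Δ := fun a haΨ haΦ ↦ by
    have hmem : a.IsMember := haΨ.1
    simp only [CongruenceFamily₂.Mem, not_and, not_forall] at haΦ
    obtain ⟨p, hp, hpa⟩ := haΦ hmem
    have hres : Φ.residueOf p a ∈ (if p < Y' then Φ.residues p else Set.univ) := haΨ.2 p hp
    have hpY' : Y' ≤ p := by
      by_contra hlt
      rw [not_le] at hlt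
      rw [if_pos hlt] at hres
      exact hpa hres
    refine ⟨p, hYY'.trans hpY', hp, ?_⟩
    by_contra hndvd
    exact hpa (hp₀ p (hp₀Y'.trans hpY') hp a hmem hndvd)
  refine ⟨Ψ, hsub, hN Y' (le_max_right _ _), ?_⟩
  have h := card_below_le_of_tail (Φ := Φ) (Ψ := Ψ) hT (mul_pos hδ hκ).le hκ hY hrelκ
  have hδκ : δ * κ / κ = δ := by field_simp
  rw [hδκ] at h
  exact h

/-! ### §4 The instances for crux I1 (`f = #Sel₃`, `c = 36`) -/

/-- **I1 on one large family from its truncations.** For a large `Φ ⊆ F₂` of positive lower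
relative density: if `avg #Sel₃ ≤ 36` holds (as `AverageOnLE`) on the finitely-conditioned
truncations `Φ_{<Y}` for all large `Y`, and the `p² ∣ Δ` tail estimate holds, then
`Φ.AverageOnLE (fun a ↦ #Sel₃(E_a)) 36`. [cite: BhargavaHo2022, §9.1–9.2 (shape of the passage to large families)] -/
theorem selmerThreeAverageLE_of_truncations (Φ : CongruenceFamily₂) (hΦ : Φ.IsLarge)
    (hrel : ∃ κ : ℝ, 0 < κ ∧ ∀ᶠ X : ℕ in atTop,
      κ * ((CongruenceFamily₂.all.below X).card : ℝ) ≤ (Φ.below X).card)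
    (htrunc : ∀ᶠ Y : ℕ in atTop,
      (⟨Φ.expt, fun p ↦ if p < Y then Φ.residues p else Set.univ⟩ : CongruenceFamily₂).AverageOnLE
        (fun a ↦ (Nat.card (a.curve.selmerGroup 3) : ℝ)) 36)
    (htail : ∀ η : ℝ, 0 < η → ∃ Y : ℕ, ∀ᶠ X : ℕ in atTop,
      (((CongruenceFamily₂.all.below X).filter fun a ↦
          ∃ p : ℕ, Y ≤ p ∧ p.Prime ∧ (p : ℤ) ^ 2 ∣ a.curveInt.Δ).card : ℝ) ≤
        η * (CongruenceFamily₂.all.below X).card) :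
    Φ.AverageOnLE (fun a ↦ (Nat.card (a.curve.selmerGroup 3) : ℝ)) 36 :=
  averageOnLE_of_isLarge_of_truncations hΦ (fun _ ↦ Nat.cast_nonneg _) (by norm_num) hrel htrunc
    htail

/-- A family with an EMPTY local condition at some prime has no members, so every average over it
is the junk value `0` and `AverageOnLE f c` holds for every `c ≥ 0`. [folklore] -/
theorem averageOnLE_of_residues_eq_empty (Φ : CongruenceFamily₂) {p : ℕ} (hp : p.Prime)
    (hempty : Φ.residues p = ∅) (f : Params → ℝ) {c : ℝ} (hc : 0 ≤ c) : Φ.AverageOnLE f c :=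
  averageOnLE_of_forall_le Φ hc fun a ha ↦ by
    have h := ha.2 p hp
    rw [hempty] at h
    exact absurd h (Set.notMem_empty _)

/-- A family with NO condition at the primes `p ≥ Y` ("finitely many congruence conditions") is
large (with `p₀ = Y`). [cite: BhargavaHo2022, §1 (definition of "large")] -/
theorem isLarge_of_residues_eq_univ (Ψ : CongruenceFamily₂) {Y : ℕ}
    (hY : ∀ p : ℕ, Y ≤ p → Ψ.residues p = Set.univ) : Ψ.IsLarge :=
  ⟨Y, fun p hp _ a _ _ ↦ by rw [hY p hp]; exact Set.mem_univ _⟩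

/-- I1 implies its finitely-conditioned case (such families are large): the reduction below loses
nothing. [cite: BhargavaHo2022, §1 (definition of "large")] -/
theorem selmerThreeAverage_finiteConditions_of_largeF2 (h : SelmerThreeAverageLargeF2)
    (Ψ : CongruenceFamily₂) (hY : ∃ Y : ℕ, ∀ p : ℕ, Y ≤ p → Ψ.residues p = Set.univ) :
    Ψ.AverageOnLE (fun a ↦ (Nat.card (a.curve.selmerGroup 3) : ℝ)) 36 := by
  obtain ⟨Y, hY⟩ := hY
  exact h Ψ (isLarge_of_residues_eq_univ Ψ hY)

/-- **The route decl I1 from I1 on finitely-conditioned families + the tail estimate + Bhargava–Ho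
Thm. 9.1.** If (i) every subfamily `Ψ ⊆ F₂` defined by FINITELY many congruence conditions (no
condition at the primes `p ≥ Y`, some `Y`) satisfies `avg #Sel₃ ≤ 36` (`AverageOnLE`), (ii) the
members of `F₂(<X)` with `p² ∣ Δ` for some prime `p ≥ Y` have upper relative density `≤ η` for
`Y ≥ Y(η)`, every `η > 0` (the uniformity estimate), and (iii) Bhargava–Ho's Thm. 9.1 holds
(`thm9_1_F2`: a large family with nonempty local conditions has `#Φ(<X) ~ c_Φ X^{2/3}`, `c_Φ > 0`;
used through `thm9_1_F2.relative`), then `SelmerThreeAverageLargeF2` holds (BY NAME): apply the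
sieve reduction to the truncations `Φ_{<Y}` of a large `Φ`; a large `Φ` with an empty local
condition is empty and needs nothing. With `selmerThreeAverage_finiteConditions_of_largeF2`: modulo
(ii) and (iii), I1 is EQUIVALENT to its finitely-conditioned case.
[cite: BhargavaHo2022, Thm. 9.1, Prop. 9.2, Thm. 9.6 (§9); BhargavaShankarAnnals2015, §2.7] -/
theorem selmerThreeAverageLargeF2_of_finiteConditions (h9 : thm9_1_F2)
    (htail : ∀ η : ℝ, 0 < η → ∃ Y : ℕ, ∀ᶠ X : ℕ in atTop,
      (((CongruenceFamily₂.all.below X).filter fun a ↦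
          ∃ p : ℕ, Y ≤ p ∧ p.Prime ∧ (p : ℤ) ^ 2 ∣ a.curveInt.Δ).card : ℝ) ≤
        η * (CongruenceFamily₂.all.below X).card)
    (hfin : ∀ Ψ : CongruenceFamily₂, (∃ Y : ℕ, ∀ p : ℕ, Y ≤ p → Ψ.residues p = Set.univ) →
      Ψ.AverageOnLE (fun a ↦ (Nat.card (a.curve.selmerGroup 3) : ℝ)) 36) :
    SelmerThreeAverageLargeF2 := by
  intro Φ hΦ
  by_cases hne : ∀ p : ℕ, p.Prime → (Φ.residues p).Nonempty
  · refine selmerThreeAverageLE_of_truncations Φ hΦ (thm9_1_F2.relative h9 Φ hΦ hne)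
      (Filter.Eventually.of_forall fun Y ↦ hfin _ ⟨Y, fun p hp ↦ ?_⟩) htail
    show (if p < Y then Φ.residues p else Set.univ) = Set.univ
    rw [if_neg (not_lt.2 hp)]
  · simp only [not_forall] at hne
    obtain ⟨p, hp, hempty⟩ := hne
    exact averageOnLE_of_residues_eq_empty Φ hp (Set.not_nonempty_iff_eq_empty.1 hempty) _
      (by norm_num)

end Summit.BirchSwinnertonDyer.BirchSwinnertonDyer.Theorems

end
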